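import Summits.NavierStokesRegularity.NavierStokesRegularity.Theorems.FluidComputerArchitecture
import Literature.Analysis.FluidPDE.FluidComputer.LocalCircuitShadowing
import HarnessLib

/-!
# Fluid computer, LOCAL layer: what a circuit design with GUARDED LOCAL dynamics gives for the true equations

HONEST FRAMING (verbatim, blueprint-wide): low prior, high value-of-information experiment on Tao's
machine paradigm; NOT a claim that NS blows up. No `LocalCircuit` is known to exist; every theorem
below is an implication from such a (so far uninhabited) structure.

`FluidComputerArchitecture` recorded what a `ShadowedCircuit S O s` buys; its two dynamical axioms
`shadow` / `leak` were WHOLE-TICK and UNGUARDED statements about every mild Navier–Stokes trajectory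
— not the shape any perturbative fluid estimate delivers. `Literature…FluidComputer.LocalCircuit`
(bp3 gen 7) replaces them by two INSTANTANEOUS, GUARDED inequalities, claimed only WHILE the state
is in the generation-`n` working region (readout in the open region `U ⊇` the closed `δsh`-tube of
the circuit, junk `< jbar √E_n`):

* `defect` — the readout `read n (u t)` has a right time-derivative `W` with
  `‖unit n • W - F (read n (u t))‖ ≤ ε` (`F` = the design vector field, `L`-Lipschitz on `U`);
* `junk_rate` — the junk's lower right Dini derivative is `≤ γ √E_n / unit n`;

together with finite-dimensional, certifiable circuit data (`F_lip`, the flow `Φ` with `flow_deriv`,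
`tube`, `dat`) and two lines of budget arithmetic (`gronwallBound 0 L ε τc ≤ δsh`, i.e.
`ε (e^{Lτc} - 1)/L ≤ δsh`; `jin + γ τc ≤ jrun < jbar`). The whole-tick `shadow` and `leak` are then
THEOREMS (`LocalCircuit.shadow`, `LocalCircuit.leak`: Grönwall for `ε`-approximate trajectories in
rescaled time + a Dini fence + a bootstrap over the tick), so `A.toShadowedCircuit : ShadowedCircuit
S O s` and everything of the architecture layer follows. This file records the summit-level
consequences by composition, and the one thing the local layer adds in content: the readout tracks
the circuit to within `gronwallBound 0 L ε σ = ε (e^{Lσ} - 1)/L` — SMALL early in the tick — and the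
junk is `≤ (jin + γ σ) √E_n`, linearly in rescaled time (`readout_tracks_circuit_of_localCircuit`).

Nothing here lowers the burden: `defect` ∧ `junk_rate` near a genuinely computing finite-dimensional
design is Tao's open programme in its sharpest local form (ASSEMBLY.md §2i).
-/

open Set Filter Topology
open scoped SchwartzMap ENNReal BigOperators

namespace Summit.NavierStokesRegularity.NavierStokesRegularity.Theorems.FluidComputer

open Literature.Analysis.FluidPDE Literature.Analysis.FluidPDE.Tao2016
open Literature.Analysis.FluidPDE.FluidComputer
open Literature.Analysis.FunctionSpaces (eFourierSobolevNorm)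

variable {S : CascadeSpecs} {O : Type*} [NormedAddCommGroup O] [NormedSpace ℝ O] {s : ℝ}

/-- **A circuit design with guarded local dynamics for the true Navier–Stokes equations refutes
Clay (A)** (`α > 0`, `η > 1/4`) — through `A.toShadowedCircuit`. HONEST FRAMING: an implication
from an uninhabited-as-far-as-known structure; NOT a claim that NS blows up. -/
theorem ns_blowup_of_localCircuit (A : LocalCircuit S O s) (hα : 0 < S.alpha)
    (hη : 1 / 4 < S.eta) : ¬ NavierStokesRegularity :=
  ns_blowup_of_shadowedCircuit A.toShadowedCircuit hα hη

/-- **Stable blow-up from a local design** (`0 ≤ s`): every divergence-free Schwartz datum within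
`X^s_{λ₀}`-distance `ρ √E₀` of the seed, `ρ = min (δ/Λ) (jin - jcore)`, has all its `H¹⁰_df`-mild
Navier–Stokes trajectories of lifespan `≤ T_*`. -/
theorem stableBlowup_of_localCircuit (A : LocalCircuit S O s) (hs : 0 ≤ s)
    (hα : 0 < S.alpha) (hη : 1 / 4 < S.eta)
    (w₀ : 𝓢(EuclideanSpace ℝ (Fin 3), EuclideanSpace ℝ (Fin 3)))
    (hdiv : VectorCalculus.IsDivFree ⇑w₀)
    (hnear : scaledSobolevNorm s (S.lam 0) (schwartzL2 w₀ - schwartzL2 A.u₀) <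
      ENNReal.ofReal (A.toShadowedCircuit.rho * Real.sqrt (S.Emin 0)))
    {S' : ℝ} {u : ℝ → L2C} (hu : IsMildSolutionFor eulerForm (schwartzL2 w₀) (Ico 0 S') u) :
    S' ≤ S.Tstar :=
  stableBlowup_of_shadowedCircuit A.toShadowedCircuit hs hα hη w₀ hdiv hnear hu

/-- **THE CASCADE THEOREM for a controlled local design** (`α > 0`, `η > 1/4`): along the seed's
maximal `H¹⁰_df`-mild Navier–Stokes trajectory, for EVERY generation `n` the spec's energy `E_n` is
present at frequency `≥ λ_n` at a clocked instant `t_n ≤ ∑_{k<n} Tmax k`, `t_n < S_m ≤ T_*`, and the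
`H¹⁰` norm is unbounded on `[0, S_m)` — now an implication from certifiable finite-dimensional
circuit data, static certificates, and two instantaneous guarded inequalities. -/
theorem energy_reaches_all_scales_of_localCircuit (A : LocalCircuit S O s)
    (hα : 0 < S.alpha) (hη : 1 / 4 < S.eta) (hctrl : A.toShadowedCircuit.H10Control) :
    ∃ Sm : ℝ, 0 < Sm ∧ Sm ≤ S.Tstar ∧ ∃ U : ℝ → L2C,
      IsMildSolutionFor eulerForm (schwartzL2 A.u₀) (Ico 0 Sm) U ∧
      (∀ C : ℝ, ∃ s ∈ Ico 0 Sm, ENNReal.ofReal C < eFourierSobolevNorm 10 (U s)) ∧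
      ∃ t : ℕ → ℝ, t 0 = 0 ∧ Monotone t ∧
        ∀ n, t n < Sm ∧ t n ≤ ∑ k ∈ Finset.range n, S.Tmax k ∧
          ENNReal.ofReal (S.Emin n) ≤ highFreqEnergy (S.lam n) (U (t n)) :=
  energy_reaches_all_scales_of_shadowedCircuit A.toShadowedCircuit hα hη hctrl

/-- **The computation is visible, sharply, along the blow-up trajectory**: the seed's maximal
`H¹⁰_df`-mild trajectory `U` on `[0, S_m)`, `S_m ≤ T_*`, is LOADED at generation `n` at clocked
instants `0 = t₀ ≤ t₁ ≤ …`, and during generation `n`'s tick the readout of the true solution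
follows the designed circuit orbit to within `gronwallBound 0 L ε σ = ε (e^{Lσ} - 1)/L` after
rescaled time `σ` while the junk is `≤ (jin + γ σ) √E_n` — for as long as the trajectory lives. -/
theorem readout_tracks_circuit_of_localCircuit (A : LocalCircuit S O s) (hα : 0 < S.alpha)
    (hη : 1 / 4 < S.eta) (hctrl : A.toShadowedCircuit.H10Control) :
    ∃ Sm : ℝ, 0 < Sm ∧ Sm ≤ S.Tstar ∧ ∃ U : ℝ → L2C,
      IsMildSolutionFor eulerForm (schwartzL2 A.u₀) (Ico 0 Sm) U ∧
      ∃ t : ℕ → ℝ, t 0 = 0 ∧ Monotone t ∧ (∀ n, t n < Sm) ∧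
        (∀ n, A.read n (U (t n)) ∈ A.Ain ∧
          A.junk n (U (t n)) ≤ ENNReal.ofReal (A.jin * Real.sqrt (S.Emin n))) ∧
        ∀ n σ, 0 ≤ σ → σ ≤ A.τc → t n + A.unit n * σ < Sm →
          dist (A.read n (U (t n + A.unit n * σ))) (A.Φ σ (A.read n (U (t n)))) ≤
              gronwallBound 0 (A.L : ℝ) A.ε σ ∧
            A.junk n (U (t n + A.unit n * σ)) ≤
              ENNReal.ofReal ((A.jin + A.γ * σ) * Real.sqrt (S.Emin n)) := by
  obtain ⟨Sm, hSm, hle, U, hU, -, -, t, ht0, htmono, htlt, -, hmem⟩ :=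
    allGenerationsFire_of_shadowedCircuit A.toShadowedCircuit hα hη hctrl
  have ht_nonneg : ∀ n, 0 ≤ t n := fun n => ht0 ▸ htmono (Nat.zero_le n)
  refine ⟨Sm, hSm, hle, U, hU, t, ht0, htmono, htlt, fun n => hmem n, fun n σ hσ0 hστ hlt => ?_⟩
  exact A.shadow_leak_sharp n _ Sm U hU (t n) (ht_nonneg n) (hmem n).1 (hmem n).2 σ hσ0 hστ hlt

/-- **Early in each tick the readout error is exponentially small**: with `U`, `t` as above, the
readout is within `ε σ e^{Lσ}` of the circuit after rescaled time `σ` — the quantitative statement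
("the machine is seen computing before the error budget is spent") a whole-tick axiom cannot make. -/
theorem readout_error_le_exp_of_localCircuit (A : LocalCircuit S O s) (hα : 0 < S.alpha)
    (hη : 1 / 4 < S.eta) (hctrl : A.toShadowedCircuit.H10Control) :
    ∃ Sm : ℝ, 0 < Sm ∧ Sm ≤ S.Tstar ∧ ∃ U : ℝ → L2C,
      IsMildSolutionFor eulerForm (schwartzL2 A.u₀) (Ico 0 Sm) U ∧
      ∃ t : ℕ → ℝ, t 0 = 0 ∧ Monotone t ∧ (∀ n, t n < Sm) ∧
        ∀ n σ, 0 ≤ σ → σ ≤ A.τc → t n + A.unit n * σ < Sm →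
          dist (A.read n (U (t n + A.unit n * σ))) (A.Φ σ (A.read n (U (t n)))) ≤
            A.ε * σ * Real.exp (A.L * σ) := by
  obtain ⟨Sm, hSm, hle, U, hU, t, ht0, htmono, htlt, hmem, hsharp⟩ :=
    readout_tracks_circuit_of_localCircuit A hα hη hctrl
  refine ⟨Sm, hSm, hle, U, hU, t, ht0, htmono, htlt, fun n σ hσ0 hστ hlt => ?_⟩
  exact (hsharp n σ hσ0 hστ hlt).1.trans (BDSV.gronwallBound_zero_le A.L.coe_nonneg A.ε_nonneg)

end Summit.NavierStokesRegularity.NavierStokesRegularity.Theorems.FluidComputer
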